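import Mathlib
import HarnessLib
import Literature.Analysis.Complex.CoincidenceLemma
import Summits.Parity.BatemanHorn.Theses.AlmostPrimeZeros

/-!
# `DeficitFromRepulsion` (route AlmostPrimeZeros, item stmt-Parity-11328)

For an exponent sequence `e : ℕ → ℕ` and `x : ℕ` put `P = ∑_{n ≤ x} X^{e n} ∈ ℂ[X]`
(the almost-prime polynomial when `e = s_f`), so `P(1) = x + 1 ≠ 0`, `P'(1) = ∑ e(n)`,
`P''(1) = ∑ (e(n)² − e(n))`.  Since `P` splits over `ℂ`, the logarithmic derivative is
`P'/P = ∑_ρ (z − ρ)⁻¹` (Mathlib `Polynomial.Splits.eval_derivative_div_eval_of_ne_zero`) and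
differentiating once more
(`Literature.Analysis.Complex.PolyaSchur.eval_derivative_derivative_div_eval`)
`P''/P = (∑_ρ (z − ρ)⁻¹)² − ∑_ρ (z − ρ)⁻²` at the non-root `z = 1`.  Hence, with `N = x + 1`,
`m₁ = ∑ e / N`, `q = ∑ e² / N`, `v = q − m₁²`:

`∑_ρ (1 − ρ)⁻² = m₁² − (q − m₁) = m₁ − v`   (`sum_inv_one_sub_sq_roots_eq`),

and termwise `Re (w²)⁻¹ ≤ ‖(w²)⁻¹‖ = (‖w‖²)⁻¹` gives `m₁ − v ≤ ∑_ρ ‖1 − ρ‖⁻²`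
(`deficit_le_sum_inv_norm_sq_roots`; equality iff `P` is real-rooted).  Specialised to `e = s_f`
this is exactly `SystemZeroRepulsion → SystemMomentDeficit` with the same constant `C`.

Sources: Pólya–Szegő 1925 (Part V, sums `∑ (z − ρ)⁻ᵏ` over the zeros of a polynomial),
Obreschkoff 1963, Marden 1966 (logarithmic derivative of a polynomial); the computation itself
is folklore.
-/

noncomputable section

namespace Summit.Parity.BatemanHorn.Theorems

open Polynomial Finset

section Algebra

variable (e : ℕ → ℕ) (x : ℕ)

/-- `P(1) = x + 1` for `P = ∑_{n ≤ x} X^{e n}`. -/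
theorem eval_one_sum_X_pow :
    (∑ n ∈ range (x + 1), (X : ℂ[X]) ^ (e n)).eval 1 = (x : ℂ) + 1 := by
  simp [eval_finsetSum]

/-- `P'(1) = ∑ e(n)` for `P = ∑_{n ≤ x} X^{e n}`. -/
theorem eval_one_derivative_sum_X_pow :
    (derivative (∑ n ∈ range (x + 1), (X : ℂ[X]) ^ (e n))).eval 1 =
      ∑ n ∈ range (x + 1), (e n : ℂ) := by
  simp [derivative_X_pow, eval_finsetSum]

/-- `m · (m − 1) = m² − m` with natural subtraction inside the cast (both sides vanish at
`m = 0`). -/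
theorem natCast_mul_natCast_sub_one (m : ℕ) :
    (m : ℂ) * ((m - 1 : ℕ) : ℂ) = (m : ℂ) ^ 2 - m := by
  rcases m with _ | m
  · simp
  · push_cast
    ring

/-- `P''(1) = ∑ (e(n)² − e(n))` for `P = ∑_{n ≤ x} X^{e n}`. -/
theorem eval_one_derivative_derivative_sum_X_pow :
    (derivative (derivative (∑ n ∈ range (x + 1), (X : ℂ[X]) ^ (e n)))).eval 1 =
      ∑ n ∈ range (x + 1), ((e n : ℂ) ^ 2 - (e n : ℂ)) := by
  simp only [derivative_sum, derivative_X_pow, derivative_C_mul, eval_finsetSum, eval_mul,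
    eval_C, eval_pow, eval_X, one_pow, mul_one]
  refine Finset.sum_congr rfl fun n _ => ?_
  exact natCast_mul_natCast_sub_one (e n)

/-- **Root-sum identity** `∑_ρ (1 − ρ)⁻² = m₁ − v`.  For `P = ∑_{n ≤ x} X^{e n} ∈ ℂ[X]`
(roots `ρ` with multiplicity, `N = x + 1`):
`∑_ρ ((1 − ρ)²)⁻¹ = ∑e/N − (∑e²/N − (∑e/N)²)` (as a complex number). [folklore] -/
theorem sum_inv_one_sub_sq_roots_eq :
    (((∑ n ∈ range (x + 1), (X : ℂ[X]) ^ (e n)).roots.map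
        fun ρ : ℂ => (((1 : ℂ) - ρ) ^ 2)⁻¹).sum : ℂ) =
      ((((∑ n ∈ range (x + 1), e n : ℕ) : ℝ) / ((x : ℝ) + 1) -
        ((((∑ n ∈ range (x + 1), (e n) ^ 2 : ℕ)) : ℝ) / ((x : ℝ) + 1) -
          (((∑ n ∈ range (x + 1), e n : ℕ) : ℝ) / ((x : ℝ) + 1)) ^ 2) : ℝ) : ℂ) := by
  set P : ℂ[X] := ∑ n ∈ range (x + 1), (X : ℂ[X]) ^ (e n) with hP
  have hN : ((x : ℂ) + 1) ≠ 0 := by exact_mod_cast Nat.succ_ne_zero x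
  have hP1 : P.eval 1 ≠ 0 := by rw [hP, eval_one_sum_X_pow]; exact hN
  have h2 := Literature.Analysis.Complex.PolyaSchur.eval_derivative_derivative_div_eval hP1
  have h1 : P.derivative.eval 1 / P.eval 1 = (P.roots.map fun a => ((1 : ℂ) - a)⁻¹).sum := by
    rw [(IsAlgClosed.splits P).eval_derivative_div_eval_of_ne_zero hP1]
    simp only [one_div]
  -- `S₂ = S₁² − P''(1)/P(1)`
  have hS2 : (P.roots.map fun ρ : ℂ => (((1 : ℂ) - ρ) ^ 2)⁻¹).sum =
      (P.derivative.eval 1 / P.eval 1) ^ 2 - P.derivative.derivative.eval 1 / P.eval 1 := by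
    rw [h2, h1]; ring
  rw [hS2, hP, eval_one_sum_X_pow, eval_one_derivative_sum_X_pow,
    eval_one_derivative_derivative_sum_X_pow, Finset.sum_sub_distrib]
  push_cast
  field_simp
  ring

/-- Termwise comparison `Re (w²)⁻¹ ≤ (‖w‖²)⁻¹`
(`Re z ≤ ‖z‖` and `‖(w²)⁻¹‖ = ‖w‖⁻²`). -/
theorem re_inv_sq_le_inv_norm_sq (w : ℂ) : ((w ^ 2)⁻¹).re ≤ (‖w‖ ^ 2)⁻¹ := by
  calc ((w ^ 2)⁻¹).re ≤ ‖(w ^ 2)⁻¹‖ := Complex.re_le_norm _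
    _ = (‖w‖ ^ 2)⁻¹ := by rw [norm_inv, norm_pow]

/-- Real part of a multiset sum of complex numbers. -/
theorem re_multiset_sum_map {ι : Type*} (s : Multiset ι) (g : ι → ℂ) :
    (s.map g).sum.re = (s.map fun i => (g i).re).sum := by
  have h := map_multiset_sum Complex.reAddGroupHom (s.map g)
  rw [Multiset.map_map] at h
  exact h

/-- **Deficit ≤ repulsion.** For `P = ∑_{n ≤ x} X^{e n} ∈ ℂ[X]` and `N = x + 1`:
`∑e/N − (∑e²/N − (∑e/N)²) ≤ ∑_ρ ‖1 − ρ‖⁻²` (roots with multiplicity), i.e. `m₁ − v ≤ T`.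
[folklore] -/
theorem deficit_le_sum_inv_norm_sq_roots :
    ((∑ n ∈ range (x + 1), e n : ℕ) : ℝ) / ((x : ℝ) + 1) -
      ((((∑ n ∈ range (x + 1), (e n) ^ 2 : ℕ)) : ℝ) / ((x : ℝ) + 1) -
        (((∑ n ∈ range (x + 1), e n : ℕ) : ℝ) / ((x : ℝ) + 1)) ^ 2) ≤
    ((∑ n ∈ range (x + 1), (X : ℂ[X]) ^ (e n)).roots.map
      (fun ρ : ℂ => (‖(1 : ℂ) - ρ‖ ^ 2)⁻¹)).sum := by
  have key := congrArg Complex.re (sum_inv_one_sub_sq_roots_eq e x)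
  rw [Complex.ofReal_re] at key
  rw [← key, re_multiset_sum_map]
  exact Multiset.sum_map_le_sum_map _ _ fun ρ _ => re_inv_sq_le_inv_norm_sq ((1 : ℂ) - ρ)

end Algebra

/-- **Item stmt-Parity-11328 (`DeficitFromRepulsion`).**
`SystemZeroRepulsion → SystemMomentDeficit`: for every Bateman–Horn system the factorial-moment
deficit `m₁(x) − v(x)` of the capped statistic `s_f` is at most `T_f(x) = ∑_ρ ‖1 − ρ‖⁻²`
(by `deficit_le_sum_inv_norm_sq_roots` with `e = s_f`), hence bounded by the same constant
`C_f`. -/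
theorem DeficitFromRepulsion_proof :
    Summit.Parity.BatemanHorn.Theses.AlmostPrimeZeros.DeficitFromRepulsion := by
  unfold Summit.Parity.BatemanHorn.Theses.AlmostPrimeZeros.DeficitFromRepulsion
    Summit.Parity.BatemanHorn.Theses.AlmostPrimeZeros.SystemZeroRepulsion
    Summit.Parity.BatemanHorn.Theses.AlmostPrimeZeros.SystemMomentDeficit
  intro hZ k f hf
  obtain ⟨C, hC⟩ := hZ k f hf
  refine ⟨C, fun x hx => le_trans ?_ (hC x hx)⟩
  exact deficit_le_sum_inv_norm_sq_roots
    (fun n => ∑ i, (((f i).eval (n : ℤ)).toNat.factorization.sum fun _ v => min v 2)) x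

end Summit.Parity.BatemanHorn.Theorems

end
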